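import Literature.NumberTheory.NumberFields.UnramifiedDescentPrimeDegree
import HarnessLib

/-!
# Unramifiedness lifts to a compositum of prime degree (the converse bookkeeping of the absorption lemma)

Topic `NumberTheory/NumberFields`.  Theorem-only companion of `UnramifiedDescentPrimeDegree.lean`.
In a square of number fields `F ⊆ E ⊆ N`, `F ⊆ M ⊆ N`:

* `ramificationIdx_le_of_isUnramifiedAt_base` — if `E/F` is unramified at `𝔮 = 𝔔 ∩ 𝓞_E`, then
  `e(𝔔 | 𝔔 ∩ 𝓞_M) ≤ e(𝔔 | 𝔮) ≤ [N : E]`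
  (`e(𝔔|𝔔∩𝓞_M) ≤ e(𝔔∩𝓞_M|𝔭)·e(𝔔|𝔔∩𝓞_M) = e(𝔔|𝔭) = e(𝔮|𝔭)·e(𝔔|𝔮) = e(𝔔|𝔮)`, Neukirch I (8.2));
* `isUnramifiedAt_of_prime_finrank_of_isUnramifiedAt_base` — **base change**: if `N/M` is Galois of
  prime degree `p`, `[N : E] < p`, and `E/F` is unramified at every maximal ideal, then `N/M` is
  unramified at every maximal ideal (`e(𝔔|𝔔∩𝓞_M)` divides `p` and is `< p`).

The typical use (Scholz's reflection theorem, Washington's proof of Thm 10.10): `E/K` an unramified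
cyclic cubic extension, `M = K(√−3)`, `N = EM`: then `N/M` is an unramified cyclic cubic (Kummer)
extension.

## References

* J. Neukirch, *Algebraic Number Theory* (1999), Ch. I §8 Prop. (8.2), §9 Prop. (9.3) (proof:
  `n = efr`) (PDF pp. 50, 60). [NeukirchANT1999]
* L. C. Washington, *Introduction to Cyclotomic Fields*, GTM 83 (2nd ed. 1997), Thm 10.10 (proof).
  [Washington1997]
-/

noncomputable section

open NumberField Module

namespace Literature.NumberTheory.NumberFields

variable {F E : Type*} [Field F] [NumberField F] [Field E] [NumberField E] [Algebra F E]
variable {M N : Type*} [Field M] [NumberField M] [Field N] [NumberField N]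
  [Algebra F M] [Algebra F N] [Algebra E N] [Algebra M N] [IsScalarTower F E N] [IsScalarTower F M N]

/-- In the square `F ⊆ E ⊆ N`, `F ⊆ M ⊆ N`: if `E/F` is unramified at `𝔔 ∩ 𝓞_E` then
`e(𝔔 | 𝔔 ∩ 𝓞_M) ≤ [N : E]`. [cite: NeukirchANT1999, Ch. I §8 Prop. (8.2) (PDF p. 50)] -/
theorem ramificationIdx_le_of_isUnramifiedAt_base (𝔔 : Ideal (𝓞 N)) [𝔔.IsMaximal]
    (hE : Algebra.IsUnramifiedAt (𝓞 F) (𝔔.under (𝓞 E))) :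
    𝔔.ramificationIdx (𝓞 M) ≤ finrank E N := by
  -- the primes below `𝔔`
  set 𝔓 : Ideal (𝓞 M) := 𝔔.under (𝓞 M) with h𝔓
  set 𝔮 : Ideal (𝓞 E) := 𝔔.under (𝓞 E) with h𝔮
  set 𝔭 : Ideal (𝓞 F) := 𝔔.under (𝓞 F) with h𝔭
  haveI : 𝔓.IsMaximal := Ideal.IsMaximal.under (𝓞 M) 𝔔
  haveI : 𝔮.IsMaximal := Ideal.IsMaximal.under (𝓞 E) 𝔔
  haveI : 𝔭.IsMaximal := Ideal.IsMaximal.under (𝓞 F) 𝔔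
  haveI : 𝔔.LiesOver 𝔓 := ⟨rfl⟩
  haveI : 𝔔.LiesOver 𝔮 := ⟨rfl⟩
  haveI : 𝔔.LiesOver 𝔭 := ⟨rfl⟩
  haveI : 𝔓.LiesOver 𝔭 := ⟨by rw [h𝔓, h𝔭, Ideal.under_under]⟩
  haveI : 𝔮.LiesOver 𝔭 := ⟨by rw [h𝔮, h𝔭, Ideal.under_under]⟩
  have h𝔭0 : 𝔭 ≠ ⊥ := Ring.ne_bot_of_isMaximal_of_not_isField ‹_› (RingOfIntegers.not_isField F)
  have h𝔮0 : 𝔮 ≠ ⊥ := Ring.ne_bot_of_isMaximal_of_not_isField ‹_› (RingOfIntegers.not_isField E)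
  have h𝔔0 : 𝔔 ≠ ⊥ := Ring.ne_bot_of_isMaximal_of_not_isField ‹_› (RingOfIntegers.not_isField N)
  -- `e(𝔔|𝔓) ≤ e(𝔓|𝔭) e(𝔔|𝔓) = e(𝔔|𝔭)`
  haveI := noZeroSMulDivisors_ringOfIntegers (F := F) (E := M)
  haveI := noZeroSMulDivisors_ringOfIntegers (F := F) (E := N)
  haveI := noZeroSMulDivisors_ringOfIntegers (F := E) (E := N)
  have hM : 𝔓.ramificationIdx (𝓞 F) ≠ 0 := by
    rw [← Ideal.ramificationIdx'_eq_ramificationIdx 𝔭 𝔓 h𝔭0]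
    exact Ideal.IsDedekindDomain.ramificationIdx'_ne_zero_of_liesOver 𝔓 h𝔭0
  have h1 : 𝔔.ramificationIdx (𝓞 M) ≤ 𝔔.ramificationIdx (𝓞 F) := by
    rw [Ideal.ramificationIdx_tower (R := 𝓞 F) 𝔓 𝔔]
    exact Nat.le_mul_of_pos_left _ (Nat.pos_of_ne_zero hM)
  -- `e(𝔔|𝔭) = e(𝔮|𝔭) e(𝔔|𝔮) = e(𝔔|𝔮)`
  have h2 : 𝔔.ramificationIdx (𝓞 F) = 𝔔.ramificationIdx (𝓞 E) := by
    rw [Ideal.ramificationIdx_tower (R := 𝓞 F) 𝔮 𝔔]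
    haveI := hE
    rw [Ideal.ramificationIdx_eq_one_of_isUnramifiedAt (p := 𝔮) (R := 𝓞 F), one_mul]
  -- `e(𝔔|𝔮) ≤ [N : E]`
  have h3 : 𝔔.ramificationIdx (𝓞 E) ≤ finrank E N := by
    rw [← Ideal.ramificationIdx'_eq_ramificationIdx 𝔮 𝔔 h𝔮0]
    exact Ideal.ramificationIdx_le_finrank (𝓞 N) E N 𝔔
  calc 𝔔.ramificationIdx (𝓞 M) ≤ 𝔔.ramificationIdx (𝓞 F) := h1
    _ = 𝔔.ramificationIdx (𝓞 E) := h2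
    _ ≤ finrank E N := h3

/-- **Base change of unramifiedness.**  In the square `F ⊆ E ⊆ N`, `F ⊆ M ⊆ N` of number fields, let
`N/M` be Galois of prime degree `p` with `[N : E] < p`, and let `E/F` be unramified at every maximal
ideal of `𝓞_E`.  Then `N/M` is unramified at every maximal ideal of `𝓞_N`: `e(𝔔|𝔔∩𝓞_M)` divides
`p` and is `≤ [N : E] < p`. [cite: NeukirchANT1999, Ch. I §8 Prop. (8.2); §9 Prop. (9.3) (proof) (PDF pp. 50, 60)]
[cite: Washington1997, Thm 10.10 (proof)] -/
theorem isUnramifiedAt_of_prime_finrank_of_isUnramifiedAt_base [IsGalois M N] {p : ℕ}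
    (hp : p.Prime) (hN : finrank M N = p) (hEN : finrank E N < p)
    (hE : ∀ (𝔮 : Ideal (𝓞 E)) (_ : 𝔮.IsMaximal), Algebra.IsUnramifiedAt (𝓞 F) 𝔮)
    (𝔔 : Ideal (𝓞 N)) [𝔔.IsMaximal] : Algebra.IsUnramifiedAt (𝓞 M) 𝔔 := by
  set 𝔓 : Ideal (𝓞 M) := 𝔔.under (𝓞 M) with h𝔓
  haveI : 𝔓.IsMaximal := Ideal.IsMaximal.under (𝓞 M) 𝔔
  haveI : 𝔔.LiesOver 𝔓 := ⟨rfl⟩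
  haveI : (𝔔.under (𝓞 E)).IsMaximal := Ideal.IsMaximal.under (𝓞 E) 𝔔
  have hle : 𝔔.ramificationIdx (𝓞 M) ≤ finrank E N :=
    ramificationIdx_le_of_isUnramifiedAt_base (F := F) 𝔔 (hE _ inferInstance)
  have hdvd : 𝔔.ramificationIdx (𝓞 M) ∣ p := hN ▸ ramificationIdx_dvd_finrank_of_isGalois 𝔓 𝔔
  rcases (Nat.dvd_prime hp).mp hdvd with h | h
  · exact Ideal.ramificationIdx_eq_one_iff.mp h
  · exact absurd (h ▸ hle) (not_le.mpr hEN)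

end Literature.NumberTheory.NumberFields

end
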